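import Literature.MathematicalPhysics.StatisticalMechanics.PeriodicRieszKernel
import Literature.Analysis.FunctionSpaces.TorusHeatKernel
import Mathlib.MeasureTheory.Integral.ExpDecay
import Mathlib.Analysis.SpecialFunctions.Pow.Asymptotics
import HarnessLib

/-!
# The periodic Riesz kernel: theta identity, continuity, positive type

Analytic API for `Literature.MathematicalPhysics.StatisticalMechanics.periodicRieszKernel`
(`PeriodicRieszKernel.lean`, definition request `defn-PeriodicRieszKernel(-2)` of route
`AtomisticToContinuum/BECRieszShadow`, items `RieszKernelPositiveType` / `RieszJastrowCondensate`).
Everything here is PROVED; no named fact is introduced.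

## Contents

* **Theta (Poisson) identity** for the `Lℤ³`-periodised heat kernel of `ℝ³`:
  `Σ_{m ∈ ℤ³} G_t(x - Lm) = L⁻³ p_{t/L²}(x/L)`, where `p_τ(y) = Σ_{k ∈ ℤ³} e^{-4π²|k|²τ} e^{2πik·y}` is
  the heat kernel of the unit torus (`Literature.Analysis.FunctionSpaces.Torus.heatKernel`), i.e.
  `Σ_m G_t(x - Lm) = L⁻³ Σ_{k ∈ ℤ³} e^{-4π²|k|²t/L²} e^{2πik·x/L}`
  (`tsum_heatKernel_sub_latticeVec`, `hasSum_periodicHeatSum`); proof: the Gaussian factorises over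
  the coordinates, the lattice sum of a product is the product of the one-dimensional sums
  (`Torus.tsum_pi_eq_prod_tsum`), and each factor is Jacobi's imaginary transformation
  (Mathlib's `Complex.tsum_exp_neg_quadratic`, made explicit in `tsum_fourier_mul_exp_eq`).
* Consequences for `Θ_{L,t} = periodicHeatSum L t` (`t > 0 < L`): continuity in `x`, continuity in
  `t`, `|Θ_{L,t}(x)| ≤ Θ_{L,t}(0) = L⁻³ Σ_{k ≠ 0} e^{-4π²|k|²t/L²}`, exponential decay in `t`, and
  integrability of `t ↦ t^a Θ_{L,t}(x)` on `(η², ∞)` for `η ≠ 0` and every real `a`.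
* Consequences for `g = periodicRieszKernel s L η` (`L > 0`, `η ≠ 0`): **continuity**
  (`continuous_periodicRieszKernel`), coordinate periodicity `g(z + L e_k) = g(z)`,
  **conditional positive-definiteness** `Σ_i c_i = 0 → 0 ≤ Σ_{i,j} c_i c_j g(z_i - z_j)` for `s > 0`
  (`sum_sum_mul_periodicRieszKernel_nonneg`; from the positive-definiteness of the torus heat
  kernel, `Σ_{i,j} c_i c_j p_τ(y_i - y_j) = Σ_k e^{-4π²|k|²τ} |Σ_i c_i e^{2πik·y_i}|² ≥ 0`), and the
  maximum principle `|g(z)| ≤ g(0)`, whence `g(0) - g(z) ≤ 2 g(0)`.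

Not here: the self-energy bound `g(0) ≤ C_s η^{-s}` uniform in `L`, the cell-mean / Fourier
coefficient formulas for `g` itself (Fubini over the cell), and the `|x|^{-s}` asymptotics.

## Sources

Stein–Weiss, *Introduction to Fourier Analysis on Euclidean Spaces* (1971), Ch. VII §2
(Poisson summation, periodisation of the Gauss kernel); Stein, *Singular Integrals* (1970),
Ch. III §2 and Ch. V §1 (Gauss–Weierstrass semigroup, subordination); Lewin, *Coulomb and Riesz
gases* (2022) and Serfaty, *Lectures on Coulomb and Riesz gases* (2024), Ch. 3–4 (smeared
periodic Riesz kernels, positive type, Onsager's lemma). All statements below are elementary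
and tagged `[folklore]`.
-/

noncomputable section

namespace Literature.MathematicalPhysics.StatisticalMechanics

open MeasureTheory Set Filter Real UnitAddTorus
open scoped _root_.Topology
open Literature.Analysis.UnboundedOperators Literature.Analysis.FunctionSpaces
open Literature.MathematicalPhysics.QuantumManyBody.BoseGas

/-! ## The one-dimensional theta identity -/

/-- **Jacobi's imaginary transformation, explicit form**: for `t > 0` and real `y`,
`Σ_{n ∈ ℤ} e^{2πiny} e^{-4π²n²t} = (4πt)^{-1/2} Σ_{n ∈ ℤ} e^{-(n-y)²/(4t)}`
(Poisson summation for the Gaussian, Mathlib's `Complex.tsum_exp_neg_quadratic` with `a = 4πt`,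
`b = iy`; cf. `Torus.exists_pos_tsum_fourier_mul_exp`, which records only positivity). [folklore] -/
theorem tsum_fourier_mul_exp_eq {t : ℝ} (ht : 0 < t) (y : ℝ) :
    ∑' n : ℤ, fourier n (y : UnitAddCircle) *
        ((Real.exp (-(4 * π ^ 2 * t * (n : ℝ) ^ 2)) : ℝ) : ℂ) =
      (((4 * π * t) ^ (-(1 / 2 : ℝ)) *
        ∑' n : ℤ, Real.exp (-((n : ℝ) - y) ^ 2 / (4 * t)) : ℝ) : ℂ) := by
  set a : ℂ := ((4 * π * t : ℝ) : ℂ) with ha_def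
  set b : ℂ := Complex.I * (y : ℂ) with hb_def
  have hat : 0 < 4 * π * t := by positivity
  have ha : 0 < a.re := by rw [ha_def, Complex.ofReal_re]; exact hat
  have hterm : ∀ n : ℤ, fourier n (y : UnitAddCircle) *
      ((Real.exp (-(4 * π ^ 2 * t * (n : ℝ) ^ 2)) : ℝ) : ℂ) =
      Complex.exp (-π * a * (n : ℂ) ^ 2 + 2 * π * b * n) := by
    intro n
    rw [fourier_coe_apply, Complex.ofReal_exp, ← Complex.exp_add]
    congr 1
    rw [ha_def, hb_def]
    push_cast
    ring
  rw [tsum_congr hterm, Complex.tsum_exp_neg_quadratic ha b]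
  have hπC : (π : ℂ) ≠ 0 := Complex.ofReal_ne_zero.mpr Real.pi_pos.ne'
  have htC : (t : ℂ) ≠ 0 := Complex.ofReal_ne_zero.mpr ht.ne'
  have hterm' : ∀ n : ℤ, Complex.exp (-π / a * ((n : ℂ) + Complex.I * b) ^ 2) =
      ((Real.exp (-((n : ℝ) - y) ^ 2 / (4 * t)) : ℝ) : ℂ) := by
    intro n
    have hb2 : (n : ℂ) + Complex.I * b = (((n : ℝ) - y : ℝ) : ℂ) := by
      rw [hb_def, ← mul_assoc, Complex.I_mul_I]
      push_cast
      ring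
    rw [hb2, ha_def, Complex.ofReal_exp]
    congr 1
    push_cast
    field_simp
  have hpow : (1 : ℂ) / a ^ (1 / 2 : ℂ) = (((4 * π * t) ^ (-(1 / 2 : ℝ)) : ℝ) : ℂ) := by
    rw [Real.rpow_neg hat.le, ← one_div, Complex.ofReal_div, Complex.ofReal_one,
      Complex.ofReal_cpow hat.le, ha_def]
    norm_num
  rw [tsum_congr hterm', ← Complex.ofReal_tsum, hpow, ← Complex.ofReal_mul]

/-- **Scaled one-dimensional theta identity**: for `L, t > 0` and real `y`,
`(4πt)^{-1/2} Σ_{n ∈ ℤ} e^{-(y - Ln)²/(4t)} = L⁻¹ Σ_{n ∈ ℤ} e^{2πiny/L} e^{-4π²n²t/L²}`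
(the previous identity at time `t/L²` and point `y/L`). [folklore] -/
theorem tsum_gaussian_sub_mul_int_eq {L t : ℝ} (hL : 0 < L) (ht : 0 < t) (y : ℝ) :
    (((4 * π * t) ^ (-(1 / 2 : ℝ)) *
        ∑' n : ℤ, Real.exp (-(y - L * n) ^ 2 / (4 * t)) : ℝ) : ℂ) =
      ((L⁻¹ : ℝ) : ℂ) * ∑' n : ℤ, fourier n ((L⁻¹ * y : ℝ) : UnitAddCircle) *
        ((Real.exp (-(4 * π ^ 2 * (t / L ^ 2) * (n : ℝ) ^ 2)) : ℝ) : ℂ) := by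
  have htL : 0 < t / L ^ 2 := by positivity
  rw [tsum_fourier_mul_exp_eq htL, ← Complex.ofReal_mul]
  congr 1
  have hterm : ∀ n : ℤ, Real.exp (-((n : ℝ) - L⁻¹ * y) ^ 2 / (4 * (t / L ^ 2))) =
      Real.exp (-(y - L * n) ^ 2 / (4 * t)) := by
    intro n
    congr 1
    field_simp
    ring
  rw [tsum_congr hterm, ← mul_assoc]
  congr 1
  have h4πt : 0 ≤ 4 * π * t := by positivity
  rw [show 4 * π * (t / L ^ 2) = 4 * π * t / L ^ 2 by ring, Real.div_rpow h4πt (by positivity),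
    show (L ^ 2 : ℝ) = L ^ (2 : ℝ) by norm_cast, ← Real.rpow_mul hL.le]
  norm_num
  rw [Real.rpow_neg_one]
  field_simp

/-! ## The theta identity for the periodised heat kernel of `ℝ³` -/

/-- The heat kernel of `ℝ³` factorises over the coordinates:
`G_t(z) = ∏ᵢ (4πt)^{-1/2} e^{-zᵢ²/(4t)}` (`t > 0`). [folklore] -/
theorem heatKernel_eq_prod {t : ℝ} (ht : 0 < t) (z : EuclideanSpace ℝ (Fin 3)) :
    heatKernel t z = ∏ i : Fin 3, (4 * π * t) ^ (-(1 / 2 : ℝ)) * Real.exp (-(z i) ^ 2 / (4 * t)) := by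
  rw [heatKernel, finrank_euclideanSpace_fin, Finset.prod_mul_distrib,
    Finset.prod_const, Finset.card_univ, Fintype.card_fin, ← Real.exp_sum,
    EuclideanSpace.real_norm_sq_eq]
  congr 1
  · rw [← Real.rpow_natCast, ← Real.rpow_mul (by positivity)]
    norm_num
  · congr 1
    rw [neg_div, Finset.sum_div, ← Finset.sum_neg_distrib]
    refine Finset.sum_congr rfl fun i _ => ?_
    ring

/-- The shifted Gaussian factors are absolutely summable over `ℤ`. [folklore] -/
theorem summable_norm_gaussianFactor {L t : ℝ} (hL : 0 < L) (ht : 0 < t) (y : ℝ) :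
    Summable fun n : ℤ =>
      ‖(((4 * π * t) ^ (-(1 / 2 : ℝ)) * Real.exp (-(y - L * n) ^ 2 / (4 * t)) : ℝ) : ℂ)‖ := by
  have hc : 0 < L ^ 2 / (4 * t) := by positivity
  have h := (Torus.summable_int_exp_neg_mul_sq_sub hc (L⁻¹ * y)).mul_left ((4 * π * t) ^ (-(1 / 2 : ℝ)))
  refine h.congr fun n => ?_
  rw [Complex.norm_real, Real.norm_of_nonneg (by positivity)]
  congr 2
  field_simp
  ring

/-- **The periodised heat kernel as a cube of one-dimensional theta sums**: for `L, t > 0`,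
`Σ_{m ∈ ℤ³} G_t(x - Lm) = ∏ᵢ (4πt)^{-1/2} Σ_{n ∈ ℤ} e^{-(xᵢ - Ln)²/(4t)}` (the Gaussian factorises
and the absolutely convergent lattice sum of a product is the product of the sums). [folklore] -/
theorem tsum_heatKernel_sub_latticeVec_eq_prod {L t : ℝ} (hL : 0 < L) (ht : 0 < t)
    (x : EuclideanSpace ℝ (Fin 3)) :
    ∑' m : Fin 3 → ℤ, heatKernel t (x - latticeVec L m) =
      ∏ i : Fin 3, ((4 * π * t) ^ (-(1 / 2 : ℝ)) *
        ∑' n : ℤ, Real.exp (-(x i - L * n) ^ 2 / (4 * t))) := by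
  classical
  set g : Fin 3 → ℤ → ℂ := fun i n =>
    ((4 * π * t) ^ (-(1 / 2 : ℝ)) * Real.exp (-(x i - L * n) ^ 2 / (4 * t)) : ℝ) with hg_def
  have hg : ∀ i, Summable fun n => ‖g i n‖ := fun i => summable_norm_gaussianFactor hL ht (x i)
  have hterm : ∀ m : Fin 3 → ℤ, ((heatKernel t (x - latticeVec L m) : ℝ) : ℂ) = ∏ i, g i (m i) := by
    intro m
    rw [heatKernel_eq_prod ht, Complex.ofReal_prod]
    refine Finset.prod_congr rfl fun i _ => ?_
    simp [hg_def, latticeVec_apply]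
  apply Complex.ofReal_injective
  rw [Complex.ofReal_tsum, tsum_congr hterm, (Torus.tsum_pi_eq_prod_tsum hg).2, Complex.ofReal_prod]
  refine Finset.prod_congr rfl fun i _ => ?_
  rw [Complex.ofReal_mul, Complex.ofReal_tsum, ← tsum_mul_left]
  simp [hg_def]

/-- The lattice sum `m ↦ G_t(x - Lm)` is summable (`L, t > 0`). [folklore] -/
theorem summable_heatKernel_sub_latticeVec {L t : ℝ} (hL : 0 < L) (ht : 0 < t)
    (x : EuclideanSpace ℝ (Fin 3)) :
    Summable fun m : Fin 3 → ℤ => heatKernel t (x - latticeVec L m) := by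
  classical
  set g : Fin 3 → ℤ → ℂ := fun i n =>
    ((4 * π * t) ^ (-(1 / 2 : ℝ)) * Real.exp (-(x i - L * n) ^ 2 / (4 * t)) : ℝ) with hg_def
  have hg : ∀ i, Summable fun n => ‖g i n‖ := fun i => summable_norm_gaussianFactor hL ht (x i)
  have hterm : ∀ m : Fin 3 → ℤ, ((heatKernel t (x - latticeVec L m) : ℝ) : ℂ) = ∏ i, g i (m i) := by
    intro m
    rw [heatKernel_eq_prod ht, Complex.ofReal_prod]
    refine Finset.prod_congr rfl fun i _ => ?_
    simp [hg_def, latticeVec_apply]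
  have h := (Torus.tsum_pi_eq_prod_tsum hg).1
  rw [← Complex.summable_ofReal]
  exact h.congr fun m => (hterm m).symm

/-- **Theta identity (complex form).** For `L, t > 0` and `x ∈ ℝ³`,
`Σ_{m ∈ ℤ³} G_t(x - Lm) = L⁻³ p_{t/L²}(x/L)` with `p` the (complex series) heat kernel of the
unit torus `Torus.heatKernelC`: Poisson summation / periodisation of the Gauss kernel
(Stein–Weiss 1971, Ch. VII §2). [folklore] -/
theorem ofReal_tsum_heatKernel_sub_latticeVec {L t : ℝ} (hL : 0 < L) (ht : 0 < t)
    (x : EuclideanSpace ℝ (Fin 3)) :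
    ((∑' m : Fin 3 → ℤ, heatKernel t (x - latticeVec L m) : ℝ) : ℂ) =
      (((L ^ 3)⁻¹ : ℝ) : ℂ) * Torus.heatKernelC (t / L ^ 2) (Torus.proj (L⁻¹ • x)) := by
  classical
  rw [tsum_heatKernel_sub_latticeVec_eq_prod hL ht x, Complex.ofReal_prod,
    Torus.heatKernelC_eq_prod (by positivity)]
  have hfac : ∀ i : Fin 3, (((4 * π * t) ^ (-(1 / 2 : ℝ)) *
      ∑' n : ℤ, Real.exp (-(x i - L * n) ^ 2 / (4 * t)) : ℝ) : ℂ) = ((L⁻¹ : ℝ) : ℂ) *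
      ∑' n : ℤ, fourier n (Torus.proj (L⁻¹ • x) i) *
        ((Real.exp (-(4 * π ^ 2 * (t / L ^ 2) * (n : ℝ) ^ 2)) : ℝ) : ℂ) := by
    intro i
    rw [Torus.proj_smul_apply, ← tsum_gaussian_sub_mul_int_eq hL ht (x i)]
  rw [Finset.prod_congr rfl fun i _ => hfac i, Finset.prod_mul_distrib, Finset.prod_const,
    Finset.card_univ, Fintype.card_fin]
  congr 1
  push_cast
  ring

/-- **Theta identity (real form).** For `L, t > 0` and `x ∈ ℝ³`,
`Σ_{m ∈ ℤ³} G_t(x - Lm) = L⁻³ p_{t/L²}(x/L)` with `p = Torus.heatKernel` the heat kernel of the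
unit torus `ℝ³/ℤ³` (Stein–Weiss 1971, Ch. VII §2). [folklore] -/
theorem tsum_heatKernel_sub_latticeVec {L t : ℝ} (hL : 0 < L) (ht : 0 < t)
    (x : EuclideanSpace ℝ (Fin 3)) :
    ∑' m : Fin 3 → ℤ, heatKernel t (x - latticeVec L m) =
      (L ^ 3)⁻¹ * Torus.heatKernel (t / L ^ 2) (Torus.proj (L⁻¹ • x)) := by
  apply Complex.ofReal_injective
  rw [ofReal_tsum_heatKernel_sub_latticeVec hL ht x, Complex.ofReal_mul,
    Torus.ofReal_heatKernel (by positivity)]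

/-- **The periodised, mean-zero heat sum is the torus heat kernel minus its zero mode**:
`Θ_{L,t}(x) = L⁻³ (p_{t/L²}(x/L) - 1)` for `L, t > 0`. [folklore] -/
theorem periodicHeatSum_eq {L t : ℝ} (hL : 0 < L) (ht : 0 < t) (x : EuclideanSpace ℝ (Fin 3)) :
    periodicHeatSum L t x = (L ^ 3)⁻¹ * (Torus.heatKernel (t / L ^ 2) (Torus.proj (L⁻¹ • x)) - 1) := by
  rw [periodicHeatSum, tsum_heatKernel_sub_latticeVec hL ht x]
  ring

/-- **Theta identity as a Fourier series**: for `L, t > 0`,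
`Θ_{L,t}(x) = L⁻³ Σ_{k ∈ ℤ³, k ≠ 0} e^{-4π²|k|²t/L²} e^{2πik·x/L}` (absolutely convergent; the
`k = 0` mode is exactly the subtracted cell average `L⁻³`). [folklore] -/
theorem hasSum_periodicHeatSum {L t : ℝ} (hL : 0 < L) (ht : 0 < t) (x : EuclideanSpace ℝ (Fin 3)) :
    HasSum (fun k : Fin 3 → ℤ => if k = 0 then (0 : ℂ) else
        (((L ^ 3)⁻¹ : ℝ) : ℂ) * (mFourier k (Torus.proj (L⁻¹ • x)) •
          ((Torus.heatCoeff (t / L ^ 2) k : ℝ) : ℂ)))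
      ((periodicHeatSum L t x : ℝ) : ℂ) := by
  classical
  have hτ : 0 < t / L ^ 2 := by positivity
  have h1 := (hasSum_ite_sub_hasSum (Torus.hasSum_heatKernelC hτ (Torus.proj (L⁻¹ • x))) 0).mul_left
    (((L ^ 3)⁻¹ : ℝ) : ℂ)
  simp only [mFourier_zero, Torus.heatCoeff_zero_right, ContinuousMap.one_apply, one_smul,
    Complex.ofReal_one] at h1
  have h2 : ((periodicHeatSum L t x : ℝ) : ℂ) =
      (((L ^ 3)⁻¹ : ℝ) : ℂ) * (Torus.heatKernelC (t / L ^ 2) (Torus.proj (L⁻¹ • x)) - 1) := by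
    rw [periodicHeatSum_eq hL ht, Complex.ofReal_mul, Complex.ofReal_sub, Complex.ofReal_one,
      Torus.ofReal_heatKernel hτ]
  rw [h2]
  refine h1.congr_fun fun k => ?_
  split_ifs <;> simp

/-! ## Consequences for the periodised heat sum `Θ_{L,t}` -/

/-- The torus heat kernel at the origin is the full theta sum, `p_τ(0) = Σ_k e^{-4π²|k|²τ}`
(all characters equal `1` at `0`). [folklore] -/
theorem torusHeatKernel_zero {d : Type*} [Fintype d] {τ : ℝ} (hτ : 0 < τ) :
    Torus.heatKernel τ (0 : UnitAddTorus d) = ∑' k : d → ℤ, Torus.heatCoeff τ k := by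
  apply Complex.ofReal_injective
  rw [Torus.ofReal_heatKernel hτ, ← (Torus.hasSum_heatKernelC hτ 0).tsum_eq, Complex.ofReal_tsum]
  refine tsum_congr fun k => ?_
  simp [mFourier]

/-- **The value at the origin**: `Θ_{L,t}(0) = L⁻³ (Σ_{k ∈ ℤ³} e^{-4π²|k|²t/L²} - 1)
= L⁻³ Σ_{k ≠ 0} e^{-4π²|k|²t/L²}` (`L, t > 0`). [folklore] -/
theorem periodicHeatSum_zero {L t : ℝ} (hL : 0 < L) (ht : 0 < t) :
    periodicHeatSum L t 0 = (L ^ 3)⁻¹ * ((∑' k : Fin 3 → ℤ, Torus.heatCoeff (t / L ^ 2) k) - 1) := by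
  rw [periodicHeatSum_eq hL ht, smul_zero, Torus.proj_zero, torusHeatKernel_zero (by positivity)]

/-- **Domination by the value at the origin**: `|Θ_{L,t}(x)| ≤ Θ_{L,t}(0)` for `L, t > 0`
(`|p_τ(y) - 1| ≤ Σ_{k ≠ 0} e^{-4π²|k|²τ} = p_τ(0) - 1`). [folklore] -/
theorem abs_periodicHeatSum_le {L t : ℝ} (hL : 0 < L) (ht : 0 < t) (x : EuclideanSpace ℝ (Fin 3)) :
    |periodicHeatSum L t x| ≤ periodicHeatSum L t 0 := by
  rw [periodicHeatSum_eq hL ht, periodicHeatSum_zero hL ht, abs_mul, abs_of_pos (by positivity)]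
  exact mul_le_mul_of_nonneg_left (Torus.abs_heatKernel_sub_one_le (by positivity) _) (by positivity)

/-- `Θ_{L,t}` attains its maximum at the origin. [folklore] -/
theorem periodicHeatSum_le_zero {L t : ℝ} (hL : 0 < L) (ht : 0 < t) (x : EuclideanSpace ℝ (Fin 3)) :
    periodicHeatSum L t x ≤ periodicHeatSum L t 0 :=
  (le_abs_self _).trans (abs_periodicHeatSum_le hL ht x)

/-- `Θ_{L,t}(0) ≥ 0`. [folklore] -/
theorem periodicHeatSum_zero_nonneg {L t : ℝ} (hL : 0 < L) (ht : 0 < t) : 0 ≤ periodicHeatSum L t 0 :=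
  (abs_nonneg _).trans (abs_periodicHeatSum_le hL ht 0)

/-- `t ↦ Θ_{L,t}(0)` is non-increasing. [folklore] -/
theorem periodicHeatSum_zero_antitone {L t₀ t : ℝ} (hL : 0 < L) (ht₀ : 0 < t₀) (h : t₀ ≤ t) :
    periodicHeatSum L t 0 ≤ periodicHeatSum L t₀ 0 := by
  have ht : 0 < t := ht₀.trans_le h
  rw [periodicHeatSum_zero hL ht₀, periodicHeatSum_zero hL ht]
  refine mul_le_mul_of_nonneg_left (sub_le_sub_right ?_ _) (by positivity)
  have h' : t₀ / L ^ 2 ≤ t / L ^ 2 := by gcongr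
  exact Summable.tsum_le_tsum (fun k => Torus.heatCoeff_le_of_le h' k)
    (Torus.summable_heatCoeff (by positivity)) (Torus.summable_heatCoeff (by positivity))

/-- **Exponential decay for large times**: for `t ≥ L²`,
`Θ_{L,t}(0) ≤ L⁻³ e^{-4π²(t/L² - 1)} (Σ_{k ∈ ℤ³} e^{-4π²|k|²} - 1)`. [folklore] -/
theorem periodicHeatSum_zero_le_exp {L t : ℝ} (hL : 0 < L) (h : L ^ 2 ≤ t) :
    periodicHeatSum L t 0 ≤ (L ^ 3)⁻¹ * (Real.exp (-(4 * π ^ 2 * (t / L ^ 2 - 1))) *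
      ((∑' k : Fin 3 → ℤ, Torus.heatCoeff 1 k) - 1)) := by
  have hL2 : 0 < L ^ 2 := by positivity
  have ht : 0 < t := hL2.trans_le h
  rw [periodicHeatSum_zero hL ht]
  refine mul_le_mul_of_nonneg_left (Torus.tsum_heatCoeff_sub_one_le ?_) (by positivity)
  rwa [le_div_iff₀ hL2, one_mul]

/-- **Uniform exponential bound**: for `L, t₀ > 0` there is `D ≥ 0` with
`|Θ_{L,t}(x)| ≤ D e^{-4π²t/L²}` for all `t ≥ t₀` and all `x` (monotonicity on `[t₀, L²]`,
`periodicHeatSum_zero_le_exp` on `[L², ∞)`; one may take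
`D = (Θ_{L,t₀}(0) + L⁻³(Σ_k e^{-4π²|k|²} - 1)) e^{4π²}`). [folklore] -/
theorem exists_abs_periodicHeatSum_le_mul_exp {L t₀ : ℝ} (hL : 0 < L) (ht₀ : 0 < t₀) :
    ∃ D : ℝ, 0 ≤ D ∧ ∀ t : ℝ, t₀ ≤ t → ∀ x : EuclideanSpace ℝ (Fin 3),
      |periodicHeatSum L t x| ≤ D * Real.exp (-(4 * π ^ 2 / L ^ 2) * t) := by
  set A : ℝ := periodicHeatSum L t₀ 0 with hA
  set B : ℝ := (L ^ 3)⁻¹ * ((∑' k : Fin 3 → ℤ, Torus.heatCoeff 1 k) - 1) with hB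
  have hA0 : 0 ≤ A := periodicHeatSum_zero_nonneg hL ht₀
  have hB0 : 0 ≤ B :=
    mul_nonneg (by positivity) (sub_nonneg.2 (Torus.one_le_tsum_heatCoeff one_pos))
  refine ⟨(A + B) * Real.exp (4 * π ^ 2), by positivity, fun t ht x => ?_⟩
  have ht0 : 0 < t := ht₀.trans_le ht
  have hE : Real.exp (-(4 * π ^ 2 * (t / L ^ 2 - 1))) =
      Real.exp (4 * π ^ 2) * Real.exp (-(4 * π ^ 2 / L ^ 2) * t) := by
    rw [← Real.exp_add]
    congr 1
    field_simp
    ring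
  refine (abs_periodicHeatSum_le hL ht0 x).trans ?_
  rcases le_total t (L ^ 2) with htL | htL
  · -- `t ≤ L²`: monotonicity, and `e^{4π²} e^{-4π²t/L²} ≥ 1`
    have h1 : 1 ≤ Real.exp (4 * π ^ 2) * Real.exp (-(4 * π ^ 2 / L ^ 2) * t) := by
      rw [← Real.exp_add]
      refine Real.one_le_exp ?_
      have : 4 * π ^ 2 / L ^ 2 * t ≤ 4 * π ^ 2 := by
        rw [div_mul_eq_mul_div, div_le_iff₀ (by positivity)]
        exact mul_le_mul_of_nonneg_left htL (by positivity)
      linarith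
    calc periodicHeatSum L t 0 ≤ A := periodicHeatSum_zero_antitone hL ht₀ ht
      _ ≤ A + B := le_add_of_nonneg_right hB0
      _ = (A + B) * 1 := (mul_one _).symm
      _ ≤ (A + B) * (Real.exp (4 * π ^ 2) * Real.exp (-(4 * π ^ 2 / L ^ 2) * t)) :=
          mul_le_mul_of_nonneg_left h1 (add_nonneg hA0 hB0)
      _ = _ := by ring
  · calc periodicHeatSum L t 0 ≤ B * Real.exp (-(4 * π ^ 2 * (t / L ^ 2 - 1))) := by
          rw [hB, mul_assoc, mul_comm _ (Real.exp _)]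
          exact periodicHeatSum_zero_le_exp hL htL
      _ ≤ (A + B) * Real.exp (-(4 * π ^ 2 * (t / L ^ 2 - 1))) :=
          mul_le_mul_of_nonneg_right (le_add_of_nonneg_left hA0) (Real.exp_pos _).le
      _ = _ := by rw [hE]; ring

/-- **Continuity in space**: `x ↦ Θ_{L,t}(x)` is continuous for `L, t > 0`. [folklore] -/
theorem continuous_periodicHeatSum {L t : ℝ} (hL : 0 < L) (ht : 0 < t) :
    Continuous (periodicHeatSum L t) := by
  have h : periodicHeatSum L t = fun x =>
      (L ^ 3)⁻¹ * (Torus.heatKernel (t / L ^ 2) (Torus.proj (L⁻¹ • x)) - 1) :=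
    funext (periodicHeatSum_eq hL ht)
  rw [h]
  exact continuous_const.mul (((Torus.continuous_heatKernel (by positivity)).comp
    (Torus.continuous_proj.comp (continuous_const_smul L⁻¹))).sub continuous_const)

/-- **Continuity in time**: `t ↦ Θ_{L,t}(x)` is continuous on `(0, ∞)` for `L > 0`. [folklore] -/
theorem continuousOn_periodicHeatSum_time {L : ℝ} (hL : 0 < L) (x : EuclideanSpace ℝ (Fin 3)) :
    ContinuousOn (fun t => periodicHeatSum L t x) (Ioi 0) := by
  have hL2 : 0 < L ^ 2 := by positivity
  set y : UnitAddTorus (Fin 3) := Torus.proj (L⁻¹ • x) with hy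
  have h2 : Continuous fun t : ℝ => ((t / L ^ 2, y) : ℝ × UnitAddTorus (Fin 3)) :=
    (continuous_id.div_const (L ^ 2)).prodMk continuous_const
  have hmaps : MapsTo (fun t : ℝ => ((t / L ^ 2, y) : ℝ × UnitAddTorus (Fin 3))) (Ioi 0)
      (Ioi 0 ×ˢ univ) :=
    fun t ht => mk_mem_prod (div_pos ht hL2) (mem_univ _)
  have h3 := Torus.continuousOn_heatKernel_uncurry.comp h2.continuousOn hmaps
  have h3' : ContinuousOn (fun t : ℝ => Torus.heatKernel (t / L ^ 2) y) (Ioi 0) := by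
    refine h3.congr fun t _ => ?_
    simp only [Function.comp_apply]
  have h1 : ContinuousOn (fun t : ℝ => (L ^ 3)⁻¹ * (Torus.heatKernel (t / L ^ 2) y - 1)) (Ioi 0) :=
    continuousOn_const.mul (h3'.sub continuousOn_const)
  exact h1.congr fun t ht => periodicHeatSum_eq hL ht x

/-! ## Integrability of the subordination integrand and continuity of the kernel -/

/-- `t ↦ t^a e^{-ct}` is integrable on `(t₀, ∞)` for `t₀, c > 0` and every real `a`. [folklore] -/
theorem integrableOn_rpow_mul_exp_neg {a c t₀ : ℝ} (hc : 0 < c) (ht₀ : 0 < t₀) :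
    IntegrableOn (fun t : ℝ => t ^ a * Real.exp (-c * t)) (Ioi t₀) := by
  refine integrable_of_isBigO_exp_neg (b := c / 2) (by positivity) ?_ ?_
  · refine ContinuousOn.mul (fun t ht => ?_) (Continuous.continuousOn (by fun_prop))
    exact (Real.continuousAt_rpow_const t a (Or.inl (ht₀.trans_le ht).ne')).continuousWithinAt
  · have h1 : Tendsto (fun t : ℝ => t ^ a * Real.exp (-(c / 2) * t)) atTop (𝓝 0) :=
      tendsto_rpow_mul_exp_neg_mul_atTop_nhds_zero a (c / 2) (by positivity)
    have h3 := (h1.isBigO_one ℝ).mul (Asymptotics.isBigO_refl (fun t : ℝ => Real.exp (-(c / 2) * t)) atTop)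
    simp only [one_mul] at h3
    refine h3.congr' (Eventually.of_forall fun t => ?_) EventuallyEq.rfl
    simp only
    rw [mul_assoc, ← Real.exp_add]
    congr 2
    ring

/-- The subordination integrand `t ↦ t^a Θ_{L,t}(x)` is a.e.-strongly measurable on `(η², ∞)`
(`η ≠ 0`; it is continuous there). [folklore] -/
theorem aestronglyMeasurable_rpow_mul_periodicHeatSum {L η : ℝ} (hL : 0 < L) (hη : η ≠ 0) (a : ℝ)
    (x : EuclideanSpace ℝ (Fin 3)) :
    AEStronglyMeasurable (fun t => t ^ a * periodicHeatSum L t x) (volume.restrict (Ioi (η ^ 2))) := by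
  have hη2 : 0 < η ^ 2 := by positivity
  refine ContinuousOn.aestronglyMeasurable ?_ measurableSet_Ioi
  refine ContinuousOn.mul (fun t ht => ?_)
    ((continuousOn_periodicHeatSum_time hL x).mono fun t ht => hη2.trans ht)
  exact (Real.continuousAt_rpow_const t a (Or.inl (hη2.trans ht).ne')).continuousWithinAt

/-- **Integrability of the subordination integrand**: for `L > 0`, `η ≠ 0`, every real `a` and
every `x`, `t ↦ t^a Θ_{L,t}(x)` is integrable on `(η², ∞)` (continuous, and dominated by
`D t^a e^{-4π²t/L²}`). In particular the `t`-integral defining `periodicRieszKernel s L η x`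
converges for every real `s`. [folklore] -/
theorem integrableOn_rpow_mul_periodicHeatSum {L η : ℝ} (hL : 0 < L) (hη : η ≠ 0) (a : ℝ)
    (x : EuclideanSpace ℝ (Fin 3)) :
    IntegrableOn (fun t => t ^ a * periodicHeatSum L t x) (Ioi (η ^ 2)) := by
  have hη2 : 0 < η ^ 2 := by positivity
  obtain ⟨D, -, hD⟩ := exists_abs_periodicHeatSum_le_mul_exp hL hη2
  refine Integrable.mono'
    ((integrableOn_rpow_mul_exp_neg (a := a) (c := 4 * π ^ 2 / L ^ 2) (by positivity) hη2).const_mul D)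
    (aestronglyMeasurable_rpow_mul_periodicHeatSum hL hη a x) ?_
  refine (ae_restrict_iff' measurableSet_Ioi).2 (Eventually.of_forall fun t ht => ?_)
  have ht0 : 0 < t := hη2.trans ht
  rw [norm_mul, Real.norm_of_nonneg (Real.rpow_nonneg ht0.le a), Real.norm_eq_abs]
  calc t ^ a * |periodicHeatSum L t x| ≤ t ^ a * (D * Real.exp (-(4 * π ^ 2 / L ^ 2) * t)) :=
        mul_le_mul_of_nonneg_left (hD t (le_of_lt ht) x) (Real.rpow_nonneg ht0.le a)
    _ = D * (t ^ a * Real.exp (-(4 * π ^ 2 / L ^ 2) * t)) := by ring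

/-- **Continuity of the periodic Riesz kernel**: for `L > 0` and `η ≠ 0` (any real `s`),
`x ↦ periodicRieszKernel s L η x` is continuous on `ℝ³` (dominated convergence: the integrand is
continuous in `x` for each `t > 0` and dominated by `D t^{(1-s)/2} e^{-4π²t/L²}`, integrable on
`(η², ∞)`). [folklore] -/
theorem continuous_periodicRieszKernel (s : ℝ) {L η : ℝ} (hL : 0 < L) (hη : η ≠ 0) :
    Continuous (periodicRieszKernel s L η) := by
  have hη2 : 0 < η ^ 2 := by positivity
  obtain ⟨D, -, hD⟩ := exists_abs_periodicHeatSum_le_mul_exp hL hη2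
  unfold periodicRieszKernel
  refine continuous_const.mul ?_
  refine continuous_of_dominated (μ := volume.restrict (Ioi (η ^ 2)))
    (F := fun x t => t ^ ((1 - s) / 2) * periodicHeatSum L t x)
    (bound := fun t => D * (t ^ ((1 - s) / 2) * Real.exp (-(4 * π ^ 2 / L ^ 2) * t)))
    (fun x => aestronglyMeasurable_rpow_mul_periodicHeatSum hL hη _ x) (fun x => ?_) ?_ ?_
  · refine (ae_restrict_iff' measurableSet_Ioi).2 (Eventually.of_forall fun t ht => ?_)
    have ht0 : 0 < t := hη2.trans ht
    rw [norm_mul, Real.norm_of_nonneg (Real.rpow_nonneg ht0.le _), Real.norm_eq_abs]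
    calc t ^ ((1 - s) / 2) * |periodicHeatSum L t x|
        ≤ t ^ ((1 - s) / 2) * (D * Real.exp (-(4 * π ^ 2 / L ^ 2) * t)) :=
          mul_le_mul_of_nonneg_left (hD t (le_of_lt ht) x) (Real.rpow_nonneg ht0.le _)
      _ = D * (t ^ ((1 - s) / 2) * Real.exp (-(4 * π ^ 2 / L ^ 2) * t)) := by ring
  · exact (integrableOn_rpow_mul_exp_neg (by positivity) hη2).const_mul D
  · refine (ae_restrict_iff' measurableSet_Ioi).2 (Eventually.of_forall fun t ht => ?_)
    exact continuous_const.mul (continuous_periodicHeatSum hL (hη2.trans ht))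

/-! ## Coordinate periodicity -/

/-- **Periodicity along the coordinate axes**: `g(z + L e_k) = g(z)` (the form used by route
`BECRieszShadow`; `L e_k` is the lattice vector of `e_k`, cf. `BoseGas.latticeVec_single` in
`PeriodicBoseGasEq317`). [folklore] -/
theorem periodicRieszKernel_add_single (s L η : ℝ) (z : EuclideanSpace ℝ (Fin 3)) (k : Fin 3) :
    periodicRieszKernel s L η (z + EuclideanSpace.single k L) = periodicRieszKernel s L η z := by
  have h : EuclideanSpace.single k L = latticeVec L (Pi.single k 1) := by
    ext i
    rw [latticeVec_apply, PiLp.single_apply, Pi.single_apply]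
    split_ifs <;> simp
  rw [h, periodicRieszKernel_add_latticeVec]

/-! ## Positive type -/

/-- The characters are unitary: `e_k(-y) = conj (e_k(y))`. [folklore] -/
theorem mFourier_apply_neg {d : Type*} [Fintype d] (k : d → ℤ) (y : UnitAddTorus d) :
    mFourier k (-y) = (starRingEnd ℂ) (mFourier k y) := by
  simp only [mFourier, ContinuousMap.coe_mk, Pi.neg_apply, map_prod]
  refine Finset.prod_congr rfl fun i _ => ?_
  rw [fourier_apply, smul_neg, fourier_neg']

/-- **The heat kernel of the torus is positive-definite**: for `τ > 0`, points `y_i ∈ T^d` and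
real weights `c_i`, `Σ_{i,j} c_i c_j p_τ(y_i - y_j) = Σ_k e^{-4π²|k|²τ} |Σ_i c_i e^{2πik·y_i}|² ≥ 0`
(Bochner: a function with nonnegative summable Fourier coefficients is of positive type). [folklore] -/
theorem sum_sum_mul_torusHeatKernel_nonneg {d : Type*} [Fintype d] {τ : ℝ} (hτ : 0 < τ) {m : ℕ}
    (y : Fin m → UnitAddTorus d) (c : Fin m → ℝ) :
    0 ≤ ∑ i, ∑ j, c i * c j * Torus.heatKernel τ (y i - y j) := by
  classical
  set A : (d → ℤ) → ℂ := fun k => ∑ i, (c i : ℂ) * mFourier k (y i) with hA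
  have hpair : ∀ i j, HasSum (fun k : d → ℤ => (c i : ℂ) * mFourier k (y i) *
      ((starRingEnd ℂ) ((c j : ℂ) * mFourier k (y j))) * ((Torus.heatCoeff τ k : ℝ) : ℂ))
      ((c i : ℂ) * (c j : ℂ) * Torus.heatKernelC τ (y i - y j)) := by
    intro i j
    refine ((Torus.hasSum_heatKernelC hτ (y i - y j)).mul_left ((c i : ℂ) * (c j : ℂ))).congr_fun
      fun k => ?_
    rw [sub_eq_add_neg, Torus.mFourier_apply_add, mFourier_apply_neg, map_mul, Complex.conj_ofReal,
      smul_eq_mul]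
    ring
  have hsum : HasSum (fun k : d → ℤ => ∑ i, ∑ j, (c i : ℂ) * mFourier k (y i) *
      ((starRingEnd ℂ) ((c j : ℂ) * mFourier k (y j))) * ((Torus.heatCoeff τ k : ℝ) : ℂ))
      (∑ i, ∑ j, (c i : ℂ) * (c j : ℂ) * Torus.heatKernelC τ (y i - y j)) :=
    hasSum_sum fun i _ => hasSum_sum fun j _ => hpair i j
  have hterm : ∀ k : d → ℤ, ∑ i, ∑ j, (c i : ℂ) * mFourier k (y i) *
      ((starRingEnd ℂ) ((c j : ℂ) * mFourier k (y j))) * ((Torus.heatCoeff τ k : ℝ) : ℂ) =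
      ((Torus.heatCoeff τ k * ‖A k‖ ^ 2 : ℝ) : ℂ) := by
    intro k
    rw [Complex.ofReal_mul, Complex.ofReal_pow, ← Complex.mul_conj', hA, map_sum, Finset.sum_mul_sum,
      Finset.mul_sum]
    refine Finset.sum_congr rfl fun i _ => ?_
    rw [Finset.mul_sum]
    refine Finset.sum_congr rfl fun j _ => ?_
    ring
  have hval : ∑ i, ∑ j, (c i : ℂ) * (c j : ℂ) * Torus.heatKernelC τ (y i - y j) =
      ((∑ i, ∑ j, c i * c j * Torus.heatKernel τ (y i - y j) : ℝ) : ℂ) := by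
    push_cast
    refine Finset.sum_congr rfl fun i _ => Finset.sum_congr rfl fun j _ => ?_
    rw [Torus.ofReal_heatKernel hτ]
  have hsum' : HasSum (fun k : d → ℤ => ((Torus.heatCoeff τ k * ‖A k‖ ^ 2 : ℝ) : ℂ))
      (((∑ i, ∑ j, c i * c j * Torus.heatKernel τ (y i - y j) : ℝ) : ℂ)) := by
    rw [← hval]
    refine hsum.congr_fun fun k => ?_
    simp only [hterm]
  exact (Complex.hasSum_ofReal.1 hsum').nonneg fun k =>
    mul_nonneg (Torus.heatCoeff_pos τ k).le (sq_nonneg _)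

/-- The weighted double sum of `Θ_{L,t}` over a configuration, in terms of the torus heat kernel:
`Σ_{i,j} c_i c_j Θ_{L,t}(z_i - z_j) = L⁻³ Σ_{i,j} c_i c_j p_{t/L²}(z_i/L - z_j/L) - L⁻³ (Σ_i c_i)²`.
[folklore] -/
theorem sum_sum_mul_periodicHeatSum_eq {L t : ℝ} (hL : 0 < L) (ht : 0 < t) {m : ℕ}
    (z : Fin m → EuclideanSpace ℝ (Fin 3)) (c : Fin m → ℝ) :
    ∑ i, ∑ j, c i * c j * periodicHeatSum L t (z i - z j) =
      (L ^ 3)⁻¹ * (∑ i, ∑ j, c i * c j *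
        Torus.heatKernel (t / L ^ 2) (Torus.proj (L⁻¹ • z i) - Torus.proj (L⁻¹ • z j))) -
      (L ^ 3)⁻¹ * (∑ i, c i) ^ 2 := by
  have hproj : ∀ i j, Torus.proj (L⁻¹ • (z i - z j)) =
      Torus.proj (L⁻¹ • z i) - Torus.proj (L⁻¹ • z j) := by
    intro i j
    rw [smul_sub, sub_eq_add_neg, Torus.proj_add, Torus.proj_neg, ← sub_eq_add_neg]
  simp_rw [periodicHeatSum_eq hL ht, hproj]
  rw [sq (∑ i, c i), Finset.sum_mul_sum, Finset.mul_sum, Finset.mul_sum, ← Finset.sum_sub_distrib]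
  refine Finset.sum_congr rfl fun i _ => ?_
  rw [Finset.mul_sum, Finset.mul_sum, ← Finset.sum_sub_distrib]
  refine Finset.sum_congr rfl fun j _ => ?_
  ring

/-- **`Θ_{L,t}` is conditionally positive-definite**: `Σ_i c_i = 0 → 0 ≤ Σ_{i,j} c_i c_j Θ_{L,t}(z_i - z_j)`
(`L, t > 0`). [folklore] -/
theorem sum_sum_mul_periodicHeatSum_nonneg {L t : ℝ} (hL : 0 < L) (ht : 0 < t) {m : ℕ}
    (z : Fin m → EuclideanSpace ℝ (Fin 3)) (c : Fin m → ℝ) (hc : ∑ i, c i = 0) :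
    0 ≤ ∑ i, ∑ j, c i * c j * periodicHeatSum L t (z i - z j) := by
  rw [sum_sum_mul_periodicHeatSum_eq hL ht, hc]
  simp only [ne_eq, OfNat.ofNat_ne_zero, not_false_eq_true, zero_pow, mul_zero, sub_zero]
  exact mul_nonneg (by positivity) (sum_sum_mul_torusHeatKernel_nonneg (by positivity) _ c)

/-- The subordination constant is positive for `s > 0` (`Γ(s/2) > 0`). [folklore] -/
theorem rieszSubordinationConst_pos {s : ℝ} (hs : 0 < s) : 0 < rieszSubordinationConst s := by
  unfold rieszSubordinationConst
  have := Real.Gamma_pos_of_pos (by positivity : 0 < s / 2)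
  positivity

/-- The weighted double sum of the kernel is the subordination integral of the weighted double
sum of `Θ_{L,t}` (finite sums commute with the convergent `t`-integral). [folklore] -/
theorem sum_sum_mul_periodicRieszKernel_eq {s L η : ℝ} (hL : 0 < L) (hη : η ≠ 0) {m : ℕ}
    (z : Fin m → EuclideanSpace ℝ (Fin 3)) (c : Fin m → ℝ) :
    ∑ i, ∑ j, c i * c j * periodicRieszKernel s L η (z i - z j) =
      rieszSubordinationConst s * ∫ t in Ioi (η ^ 2),
        t ^ ((1 - s) / 2) * ∑ i, ∑ j, c i * c j * periodicHeatSum L t (z i - z j) := by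
  have hint : ∀ i j, IntegrableOn
      (fun t => t ^ ((1 - s) / 2) * periodicHeatSum L t (z i - z j)) (Ioi (η ^ 2)) :=
    fun i j => integrableOn_rpow_mul_periodicHeatSum hL hη _ _
  simp only [periodicRieszKernel]
  calc ∑ i, ∑ j, c i * c j * (rieszSubordinationConst s *
        ∫ t in Ioi (η ^ 2), t ^ ((1 - s) / 2) * periodicHeatSum L t (z i - z j))
      = rieszSubordinationConst s * ∑ i, ∑ j, ∫ t in Ioi (η ^ 2),
          c i * c j * (t ^ ((1 - s) / 2) * periodicHeatSum L t (z i - z j)) := by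
        rw [Finset.mul_sum]
        refine Finset.sum_congr rfl fun i _ => ?_
        rw [Finset.mul_sum]
        refine Finset.sum_congr rfl fun j _ => ?_
        rw [integral_const_mul]
        ring
    _ = rieszSubordinationConst s * ∫ t in Ioi (η ^ 2), ∑ i, ∑ j,
          c i * c j * (t ^ ((1 - s) / 2) * periodicHeatSum L t (z i - z j)) := by
        congr 1
        rw [integral_finsetSum _ fun i _ => ?_]
        · refine Finset.sum_congr rfl fun i _ => ?_
          rw [integral_finsetSum _ fun j _ => (hint i j).const_mul _]
        · exact integrable_finsetSum _ fun j _ => (hint i j).const_mul _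
    _ = _ := by
        congr 1
        refine integral_congr_ae (Eventually.of_forall fun t => ?_)
        simp only [Finset.mul_sum]
        exact Finset.sum_congr rfl fun i _ => Finset.sum_congr rfl fun j _ => by ring

/-- **The periodic Riesz kernel is conditionally positive-definite** (`0 < s`, `0 < L`, `η ≠ 0`):
for points `z_i ∈ ℝ³` and real weights with `Σ_i c_i = 0`, `0 ≤ Σ_{i,j} c_i c_j g(z_i - z_j)`.
Its Fourier coefficients `ĝ(k) = K_s L⁻³ ∫_{η²}^∞ t^{(1-s)/2} e^{-4π²|k|²t/L²} dt` are positive for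
`k ≠ 0` and `ĝ(0) = 0` (Lewin 2022; Serfaty 2024, Ch. 3–4); here derived from the positive type
of the torus heat kernel under the subordination integral. [folklore] -/
theorem sum_sum_mul_periodicRieszKernel_nonneg {s L η : ℝ} (hs : 0 < s) (hL : 0 < L) (hη : η ≠ 0)
    {m : ℕ} (z : Fin m → EuclideanSpace ℝ (Fin 3)) (c : Fin m → ℝ) (hc : ∑ i, c i = 0) :
    0 ≤ ∑ i, ∑ j, c i * c j * periodicRieszKernel s L η (z i - z j) := by
  have hη2 : 0 < η ^ 2 := by positivity
  rw [sum_sum_mul_periodicRieszKernel_eq hL hη]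
  refine mul_nonneg (rieszSubordinationConst_pos hs).le
    (setIntegral_nonneg measurableSet_Ioi fun t ht => ?_)
  have ht0 : 0 < t := hη2.trans ht
  exact mul_nonneg (Real.rpow_nonneg ht0.le _) (sum_sum_mul_periodicHeatSum_nonneg hL ht0 z c hc)

/-! ## Maximum principle: `|g(z)| ≤ g(0)` -/

/-- **`|g(z)| ≤ g(0)`** for `0 < s`, `0 < L`, `η ≠ 0` (from `|Θ_{L,t}(z)| ≤ Θ_{L,t}(0)` under the
integral). [folklore] -/
theorem abs_periodicRieszKernel_le {s L η : ℝ} (hs : 0 < s) (hL : 0 < L) (hη : η ≠ 0)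
    (x : EuclideanSpace ℝ (Fin 3)) :
    |periodicRieszKernel s L η x| ≤ periodicRieszKernel s L η 0 := by
  have hη2 : 0 < η ^ 2 := by positivity
  have hK := rieszSubordinationConst_pos hs
  simp only [periodicRieszKernel]
  rw [abs_mul, abs_of_pos hK]
  refine mul_le_mul_of_nonneg_left ?_ hK.le
  calc |∫ t in Ioi (η ^ 2), t ^ ((1 - s) / 2) * periodicHeatSum L t x|
      ≤ ∫ t in Ioi (η ^ 2), |t ^ ((1 - s) / 2) * periodicHeatSum L t x| :=
        abs_integral_le_integral_abs
    _ ≤ ∫ t in Ioi (η ^ 2), t ^ ((1 - s) / 2) * periodicHeatSum L t 0 := by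
        refine setIntegral_mono_on (integrableOn_rpow_mul_periodicHeatSum hL hη _ x).abs
          (integrableOn_rpow_mul_periodicHeatSum hL hη _ 0) measurableSet_Ioi fun t ht => ?_
        have ht0 : 0 < t := hη2.trans ht
        rw [abs_mul, abs_of_nonneg (Real.rpow_nonneg ht0.le _)]
        exact mul_le_mul_of_nonneg_left (abs_periodicHeatSum_le hL ht0 x) (Real.rpow_nonneg ht0.le _)

/-- `g` attains its maximum at the origin. [folklore] -/
theorem periodicRieszKernel_le_zero {s L η : ℝ} (hs : 0 < s) (hL : 0 < L) (hη : η ≠ 0)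
    (x : EuclideanSpace ℝ (Fin 3)) :
    periodicRieszKernel s L η x ≤ periodicRieszKernel s L η 0 :=
  (le_abs_self _).trans (abs_periodicRieszKernel_le hs hL hη x)

/-- The self-energy `g(0)` is nonnegative. [folklore] -/
theorem periodicRieszKernel_zero_nonneg {s L η : ℝ} (hs : 0 < s) (hL : 0 < L) (hη : η ≠ 0) :
    0 ≤ periodicRieszKernel s L η 0 :=
  (abs_nonneg _).trans (abs_periodicRieszKernel_le hs hL hη 0)

/-- `-g(0) ≤ g(z)`. [folklore] -/
theorem neg_periodicRieszKernel_zero_le {s L η : ℝ} (hs : 0 < s) (hL : 0 < L) (hη : η ≠ 0)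
    (x : EuclideanSpace ℝ (Fin 3)) :
    -periodicRieszKernel s L η 0 ≤ periodicRieszKernel s L η x :=
  (neg_le_neg (abs_periodicRieszKernel_le hs hL hη x)).trans (neg_abs_le _)

/-- **`0 ≤ g(0) - g(z) ≤ 2 g(0)`**, the elementary half of the self-energy estimate of route item
`RieszKernelPositiveType`. [folklore] -/
theorem periodicRieszKernel_zero_sub_mem_Icc {s L η : ℝ} (hs : 0 < s) (hL : 0 < L) (hη : η ≠ 0)
    (x : EuclideanSpace ℝ (Fin 3)) :
    periodicRieszKernel s L η 0 - periodicRieszKernel s L η x ∈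
      Icc 0 (2 * periodicRieszKernel s L η 0) := by
  have h1 := periodicRieszKernel_le_zero hs hL hη x
  have h2 := neg_periodicRieszKernel_zero_le hs hL hη x
  constructor <;> linarith

end Literature.MathematicalPhysics.StatisticalMechanics

end
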